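import Mathlib

/-!
# AnchorDial — Core (cell decomp-qadv, seat lens-2, generation 14; supports item 26531 `ExactnessDial.PolyLossOddU3`)

§4 of the node: the FOUR-FLIP CORE.  Sign patterns `σ ∈ {0,1}^4`, orbit lines `ℓ_{σ,τ}(ε) = τ + Σ ε_i σ_i` over `𝔽₃`,
`core_red` / `kleitman4` (kernel-decided), reflection transport `lv_bx`, `no_third`, `card_le_five_of_diam`,
**`card_compat_le_five`** (≤ 5 of 16 sign vectors compatible with any data) and **`core_four`** (≤ 10 of 16 when the anchor's parity
bit is hidden, `Compat₂`).

Split (≤ 400 lines, part 1/3) of the node file `HOME/decomp-qadv-lens-2/g14/AnchorDial.lean` (sha256 a954f04b…, farm rc 0, no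
placeholders); declarations verbatim, namespace `Summit.QuantumAdvantage.QuantumAdvantage.Theorems.AnchorDial.Core`.  Record: NODE-g14.md.
-/

set_option linter.dupNamespace false
set_option linter.unusedVariables false

/-! ## §4 (placed first: pure finite combinatorics, kernel-decided) The four-flip CORE -/

namespace Summit.QuantumAdvantage.QuantumAdvantage.Theorems.AnchorDial.Core

open Finset

/-- sign patterns / orbit points / reflection masks: `{0,1}^4` as a product type (kernel-friendly). -/
abbrev B4 := Bool × Bool × Bool × Bool

/-- the `𝔽₃` shift of a far pair-flip with sign bit `z`: `σ = 1 + [z] ∈ {1, 2}`. -/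
def sg (z : Bool) : ZMod 3 := if z then 2 else 1

/-- one coordinate of an orbit line: `[e]·σ`. -/
def ct (e s : Bool) : ZMod 3 := if e then sg s else 0

/-- the ORBIT LINE of the hidden trit `τ` under four commuting far pair-flips with sign vector `σ`, read at the
orbit point `ε ∈ {0,1}^4`: `τ + Σ_i ε_i σ_i`. -/
def lv (σ : B4) (τ : ZMod 3) (ε : B4) : ZMod 3 :=
  τ + ct ε.1 σ.1 + ct ε.2.1 σ.2.1 + ct ε.2.2.1 σ.2.2.1 + ct ε.2.2.2 σ.2.2.2

/-- coordinatewise reflection (xor with a mask). -/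
def bx (I ε : B4) : B4 := (xor ε.1 I.1, xor ε.2.1 I.2.1, xor ε.2.2.1 I.2.2.1, xor ε.2.2.2 I.2.2.2)

/-- Hamming weight on `{0,1}^4`. -/
def wt (σ : B4) : ℕ :=
  (if σ.1 then 1 else 0) + (if σ.2.1 then 1 else 0) + (if σ.2.2.1 then 1 else 0) + (if σ.2.2.2 then 1 else 0)

/-- Hamming distance on `{0,1}^4`. -/
def hd (σ σ' : B4) : ℕ := wt (bx σ' σ)

/-- the all-`1` sign vector (all sign bits `false`). -/
def f4 : B4 := (false, false, false, false)

/-- the translation of a line under the reflection `I`: `Σ_{i : I_i} σ_i`. -/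
def shiftC (σ I : B4) : ZMod 3 := ct I.1 σ.1 + ct I.2.1 σ.2.1 + ct I.2.2.1 σ.2.2.1 + ct I.2.2.2 σ.2.2.2

/-- **CORE, reduced by the reflection symmetry to `σ₁ = (1,1,1,1)`, `τ₁ = 0`**: a line far from it
(`wt σ₂ ≥ 3`) and any third line take three DISTINCT values at some orbit point (kernel-decided, 630 live cases). -/
theorem core_red : ∀ σ₂ σ₃ : B4, ∀ τ₂ τ₃ : ZMod 3, 3 ≤ wt σ₂ → σ₃ ≠ f4 → σ₃ ≠ σ₂ →
    ∃ ε : B4, lv f4 0 ε ≠ lv σ₂ τ₂ ε ∧ lv f4 0 ε ≠ lv σ₃ τ₃ ε ∧ lv σ₂ τ₂ ε ≠ lv σ₃ τ₃ ε := by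
  decide +kernel

/-- the radius-2 Hamming ball around `0` in `{0,1}^4` (11 points). -/
def ball2 : Finset B4 := univ.filter fun σ => wt σ ≤ 2

/-- **Kleitman's diameter theorem in `Q₄`, the instance needed**: a subset of the radius-2 ball with all pairwise
distances `≤ 2` has at most 5 points (kernel-decided over the 2048 subsets). -/
theorem kleitman4 : ∀ S ∈ ball2.powerset, (∀ σ ∈ S, ∀ σ' ∈ S, hd σ σ' ≤ 2) → S.card ≤ 5 := by
  decide +kernel

/-- four pairwise constraints in `𝔽₃`: a value cannot avoid three distinct values. -/
theorem three_avoid : ∀ t v₁ v₂ v₃ : ZMod 3, ¬ (v₁ ≠ v₂ ∧ v₁ ≠ v₃ ∧ v₂ ≠ v₃ ∧ t ≠ v₁ ∧ t ≠ v₂ ∧ t ≠ v₃) := by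
  decide

/-- AnchorDialCore helper `ct_xor` (decomp-qadv land package; see the module docstring). -/
theorem ct_xor (e i s : Bool) : ct (xor e i) s = ct i s + ct e (xor s i) := by
  revert e i s; decide

/-- reflecting the orbit cube maps lines to lines: `ℓ_{σ,τ}(ε ⊕ I) = ℓ_{σ ⊕ I, τ + c(σ,I)}(ε)`. -/
theorem lv_bx (σ I : B4) (τ : ZMod 3) (ε : B4) : lv σ τ (bx I ε) = lv (bx I σ) (τ + shiftC σ I) ε := by
  obtain ⟨e1, e2, e3, e4⟩ := ε
  obtain ⟨i1, i2, i3, i4⟩ := I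
  obtain ⟨s1, s2, s3, s4⟩ := σ
  simp only [lv, bx, shiftC, ct_xor]
  ring

/-- AnchorDialCore helper `lv_sub` (decomp-qadv land package; see the module docstring). -/
theorem lv_sub (σ : B4) (τ t : ZMod 3) (ε : B4) : lv σ (τ - t) ε = lv σ τ ε - t := by
  unfold lv; ring

/-- AnchorDialCore helper `bx_bx` (decomp-qadv land package; see the module docstring). -/
theorem bx_bx (I ε : B4) : bx I (bx I ε) = ε := by
  obtain ⟨e1, e2, e3, e4⟩ := ε
  obtain ⟨i1, i2, i3, i4⟩ := I
  simp only [bx, Bool.xor_assoc, Bool.xor_self, Bool.xor_false]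

/-- AnchorDialCore helper `bx_self` (decomp-qadv land package; see the module docstring). -/
theorem bx_self (σ : B4) : bx σ σ = f4 := by
  obtain ⟨s1, s2, s3, s4⟩ := σ
  simp only [bx, Bool.xor_self, f4]

/-- AnchorDialCore helper `xor_xor_cancel` (decomp-qadv land package; see the module docstring). -/
theorem xor_xor_cancel (a b c : Bool) : xor (xor a c) (xor b c) = xor a b := by
  revert a b c; decide

/-- reflections are isometries (kernel-decided, 4096 cases). -/
theorem hd_bx : ∀ I σ σ' : B4, hd (bx I σ) (bx I σ') = hd σ σ' := by
  decide +kernel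

/-- AnchorDialCore helper `hd_comm` (decomp-qadv land package; see the module docstring). -/
theorem hd_comm : ∀ σ σ' : B4, hd σ σ' = hd σ' σ := by
  decide +kernel

/-- `a` AVOIDS the line `(σ, τ)`: at every orbit point the data value differs from the line value. -/
def Avoids (a : B4 → ZMod 3) (σ : B4) (τ : ZMod 3) : Prop := ∀ ε, a ε ≠ lv σ τ ε

/-- the sign vector `σ` is COMPATIBLE with the data `a`: some hidden trit makes `a` avoid its line. -/
def Compat (a : B4 → ZMod 3) (σ : B4) : Prop := ∃ τ, Avoids a σ τ

/-- AnchorDialCore helper `avoids_bx` (decomp-qadv land package; see the module docstring). -/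
theorem avoids_bx {a : B4 → ZMod 3} {σ : B4} {τ : ZMod 3} (I : B4) (h : Avoids a σ τ) :
    Avoids (fun ε => a (bx I ε)) (bx I σ) (τ + shiftC σ I) := by
  intro ε
  rw [← lv_bx]
  exact h (bx I ε)

/-- AnchorDialCore helper `avoids_sub` (decomp-qadv land package; see the module docstring). -/
theorem avoids_sub {a : B4 → ZMod 3} {σ : B4} {τ : ZMod 3} (t : ZMod 3) (h : Avoids a σ τ) :
    Avoids (fun ε => a ε - t) σ (τ - t) := by
  intro ε hε
  rw [lv_sub] at hε
  exact h ε (by linear_combination hε)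

/-- **no third line**: if `a` avoids two lines at distance `≥ 3`, it avoids no third one. -/
theorem no_third {a : B4 → ZMod 3} {σ₁ σ₂ σ₃ : B4} {τ₁ τ₂ τ₃ : ZMod 3}
    (h₁ : Avoids a σ₁ τ₁) (h₂ : Avoids a σ₂ τ₂) (h₃ : Avoids a σ₃ τ₃) (hfar : 3 ≤ hd σ₁ σ₂) :
    σ₃ = σ₁ ∨ σ₃ = σ₂ := by
  by_contra hne
  push Not at hne
  set t := τ₁ + shiftC σ₁ σ₁ with ht
  have h₁' : Avoids (fun ε => a (bx σ₁ ε) - t) f4 0 := by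
    have h := avoids_sub t (avoids_bx σ₁ h₁)
    rw [bx_self, ht, sub_self] at h
    exact h
  have h₂' := avoids_sub t (avoids_bx σ₁ h₂)
  have h₃' := avoids_sub t (avoids_bx σ₁ h₃)
  have hw : 3 ≤ wt (bx σ₁ σ₂) := by
    have : hd σ₂ σ₁ = wt (bx σ₁ σ₂) := rfl
    rw [← this, hd_comm]; exact hfar
  have hinj : ∀ ρ ρ' : B4, bx σ₁ ρ = bx σ₁ ρ' → ρ = ρ' := fun ρ ρ' h => by
    have := congrArg (bx σ₁) h
    rwa [bx_bx, bx_bx] at this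
  have hne4 : bx σ₁ σ₃ ≠ f4 := fun h => hne.1 (hinj _ _ (by rw [h, bx_self]))
  have hne2 : bx σ₁ σ₃ ≠ bx σ₁ σ₂ := fun h => hne.2 (hinj _ _ h)
  obtain ⟨ε, e12, e13, e23⟩ := core_red _ _ _ _ hw hne4 hne2
  exact three_avoid _ _ _ _ ⟨e12, e13, e23, h₁' ε, h₂' ε, h₃' ε⟩

/-- a set of sign vectors of diameter `≤ 2` has at most 5 elements (translate into the ball, `kleitman4`). -/
theorem card_le_five_of_diam (S : Finset B4) (hdiam : ∀ σ ∈ S, ∀ σ' ∈ S, hd σ σ' ≤ 2) : S.card ≤ 5 := by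
  rcases S.eq_empty_or_nonempty with rfl | ⟨σ₀, h₀⟩
  · simp
  have hinj : Function.Injective (bx σ₀) := fun ρ ρ' h => by
    have := congrArg (bx σ₀) h
    rwa [bx_bx, bx_bx] at this
  rw [← card_image_of_injective S hinj]
  refine kleitman4 _ ?_ ?_
  · rw [mem_powerset]
    intro ρ hρ
    rw [mem_image] at hρ
    obtain ⟨σ, hσ, rfl⟩ := hρ
    unfold ball2
    rw [mem_filter]
    exact ⟨mem_univ _, hdiam σ hσ σ₀ h₀⟩
  · intro ρ hρ ρ' hρ'
    rw [mem_image] at hρ hρ'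
    obtain ⟨σ, hσ, rfl⟩ := hρ
    obtain ⟨σ', hσ', rfl⟩ := hρ'
    rw [hd_bx]
    exact hdiam σ hσ σ' hσ'

open scoped Classical in
/-- **at most 5 of the 16 sign vectors are compatible with any data.** -/
theorem card_compat_le_five (a : B4 → ZMod 3) : (univ.filter fun σ => Compat a σ).card ≤ 5 := by
  set S := univ.filter fun σ => Compat a σ with hS
  by_cases hfar : ∃ σ ∈ S, ∃ σ' ∈ S, 3 ≤ hd σ σ'
  · obtain ⟨σ, hσ, σ', hσ', h3⟩ := hfar
    obtain ⟨τ, hτ⟩ := (mem_filter.1 hσ).2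
    obtain ⟨τ', hτ'⟩ := (mem_filter.1 hσ').2
    have hsub : S ⊆ {σ, σ'} := by
      intro ρ hρ
      obtain ⟨τρ, hρ'⟩ := (mem_filter.1 hρ).2
      rcases no_third hτ hτ' hρ' h3 with h | h
      · rw [h]; exact mem_insert_self _ _
      · rw [h]; exact mem_insert_of_mem (mem_singleton_self _)
    exact (card_le_card hsub).trans ((card_insert_le _ _).trans (by simp))
  · push Not at hfar
    exact card_le_five_of_diam S fun σ hσ σ' hσ' => Nat.le_of_lt_succ (hfar σ hσ σ' hσ')

/-- the hidden parity bit at the anchor reflects the avoided value: `a ↦ r - a` (for window bets `r = 1`, §5). -/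
def refl (r : ZMod 3) (a : B4 → ZMod 3) : B4 → ZMod 3 := fun ε => r - a ε

/-- compatibility when the anchor's parity bit is UNKNOWN: compatible with `a` or with its reflection. -/
def Compat₂ (r : ZMod 3) (a : B4 → ZMod 3) (σ : B4) : Prop := Compat a σ ∨ Compat (refl r a) σ

open scoped Classical in
/-- **CORE (F = 4): at most 10 of the 16 sign vectors are compatible** — so a strategy whose window bet wins at all
16 points of a four-flip orbit forces the four hidden sign bits into a set of density `≤ 10/16 < 1`; with three
flips the corresponding count is `8/8` (both reflections of the parity pattern fill `{1,2}^3`), which is why the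
moving-anchor engine needs exactly one flip more than g13's. -/
theorem core_four (r : ZMod 3) (a : B4 → ZMod 3) : (univ.filter fun σ => Compat₂ r a σ).card ≤ 10 := by
  have e : (univ.filter fun σ => Compat₂ r a σ) =
      (univ.filter fun σ => Compat a σ) ∪ univ.filter fun σ => Compat (refl r a) σ := by
    ext σ; simp [Compat₂, mem_union, mem_filter]
  rw [e]
  exact (card_union_le _ _).trans (by have := card_compat_le_five a; have := card_compat_le_five (refl r a); omega)

open scoped Classical in
/-- AnchorDialCore helper `core_four_lt` (decomp-qadv land package; see the module docstring). -/
theorem core_four_lt (r : ZMod 3) (a : B4 → ZMod 3) :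
    (univ.filter fun σ => Compat₂ r a σ).card < Fintype.card B4 := by
  have : Fintype.card B4 = 16 := by rfl
  rw [this]
  exact lt_of_le_of_lt (core_four r a) (by norm_num)

end Summit.QuantumAdvantage.QuantumAdvantage.Theorems.AnchorDial.Core
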